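import Summits.NavierStokesRegularity.NavierStokesRegularity.Theorems.TerminalTraceTypeITraceScarL3ApexPackageTimeShift
import HarnessLib

/-!
# LATE-BOUNDED LIOUVILLE (stub Z1 `stub_lateBoundedLiouville` of the candidate line `radius_dichotomy`, item
# `TerminalTrace.TypeITraceScarL3`, stmt-NavierStokesRegularity-18385): an extinct Type-I apex that is a.e. bounded on
# a late WHOLE-SPACE slab vanishes on every parabolic ball `Q_a(0)`

Seat nsreg-C26-p1 g5 (cell ns-regularity-ideate), `--supports stmt-NavierStokesRegularity-18385` (helper); memo
`HOME/nsreg-C26-p1-LOUD-ZOOM-18385.md`, candidate skeleton `Cruxes/TypeITraceScarL3/Lines/radius_dichotomy_CANDIDATE.lean`.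

Proof. (1) TIME SHIFT of the apex package to an apex `s₁ ≤ 0` (`apexPackage_timeShift`: `Q_a((s₁,0)) ⊆ Q_{a+|s₁|+1}(0)`,
restriction `IsSuitableWeakSolutionInBall.of_subset_zero`, zoom/zoom-out and the scaling covariances `typeIBound_nsZoom`,
`cknD_nsZoom`, `HasWeakSpatialGradientOn.stRescale`; the rate needs `s₁ ≤ 0` and `C ≥ 0`); the weak top-vanishing at the new
apex is supplied by a.e. vanishing on a LEFT neighbourhood `]s₁ − η, s₁[` of the new apex
(`weakNull_shift_of_ae_zero`, Fubini). (2) The rate turns into a product-a.e. bound away from the top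
(`ae_prod_norm_le_of_slices`), so under the late bound `‖U‖ ≤ K` a.e. on `]−δ,0[ × ℝ³` the field is a.e. bounded by one
`L` on `]−(T+3), 0[ × ℝ³`. (3) INDUCTION: the tree-checked late sweep `lateSweep_ae_zero` clears `]−h, 0[ × ℝ³`,
`h = (min(1,1/L)/2)²`; if `]−D, 0[ × ℝ³` is cleared (`h ≤ D ≤ T`), the sweep for the package shifted to `s₁ = −(D − h/2)`
(top-vanishing there because `]s₁ − h/2, s₁[ ⊆ ]−D, 0[` is cleared) clears `]s₁ − h, s₁[`, i.e. the depth grows by `h/2`;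
`⌈2T/h⌉` steps clear `]−T, 0[ ⊇ Q_a(0)` (`T = a²`).
WHAT THIS IS NOT: 18385 / NS regularity NOT proved; this is one of five stubs of a candidate line.
[folklore; EscauriazaSereginSverak2003 Thm 5.1; AlbrittonBarker2019 §3]
-/

noncomputable section

set_option linter.dupNamespace false

namespace Summit.NavierStokesRegularity.NavierStokesRegularity.Theorems.TypeITraceScarL3

open MeasureTheory Set Function Filter Topology TopologicalSpace Metric InnerProductSpace
open Literature.Analysis.FluidPDE
open scoped NNReal ENNReal RealInnerProductSpace

/-! ### The iteration -/

set_option maxHeartbeats 1600000 in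
/-- **LATE-BOUNDED LIOUVILLE** (stub Z1 `stub_lateBoundedLiouville` of the candidate line `radius_dichotomy`, statement
VERBATIM): an extinct Type-I apex of the class which is a.e. bounded on a late whole-space slab `]−δ, 0[ × ℝ³` vanishes
a.e. on every parabolic ball `Q_a(0)`. Proof: module docstring (late sweep `lateSweep_ae_zero` + time shifts by half
the sweep depth, `⌈2a²/h⌉ + 1` times). [cite: EscauriazaSereginSverak2003, Thm. 5.1] -/
theorem lateBoundedLiouville :
    ∀ (U : ℝ → EuclideanSpace ℝ (Fin 3) → EuclideanSpace ℝ (Fin 3))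
      (P : ℝ → EuclideanSpace ℝ (Fin 3) → ℝ)
      (G : ℝ → EuclideanSpace ℝ (Fin 3) →
        EuclideanSpace ℝ (Fin 3) →L[ℝ] EuclideanSpace ℝ (Fin 3))
      (M D₀ : ℝ≥0) (C : ℝ),
      (∀ a : ℝ, 0 < a →
        IsSuitableWeakSolutionInBall a (0 : ℝ × EuclideanSpace ℝ (Fin 3)) U P) →
      (∀ a : ℝ, 0 < a →
        HasWeakSpatialGradientOn
          (parabolicCylinderOpens a (0 : ℝ × EuclideanSpace ℝ (Fin 3))) U G) →
      (∀ a : ℝ, 0 < a →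
        typeIBound (parabolicCylinder a (0 : ℝ × EuclideanSpace ℝ (Fin 3))) U P G ≤ M) →
      (∀ z₀ : ℝ × EuclideanSpace ℝ (Fin 3), z₀.1 ≤ 0 →
        ∀ r : ℝ, 0 < r → cknD r z₀ P ≤ D₀) →
      (∀ s : ℝ, s < 0 →
        ∀ᵐ y : EuclideanSpace ℝ (Fin 3), ‖U s y‖ ≤ C / Real.sqrt (-s)) →
      (∀ φ : EuclideanSpace ℝ (Fin 3) → EuclideanSpace ℝ (Fin 3),
        ContDiff ℝ (⊤ : ℕ∞) φ →
        HasCompactSupport φ → ∀ ε : ℝ, 0 < ε →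
        ∃ s₀ : ℝ, s₀ < 0 ∧ ∀ᵐ s ∂(volume.restrict (Ioo s₀ 0)), |∫ y, ⟪U s y, φ y⟫| ≤ ε) →
      (∃ δ : ℝ, 0 < δ ∧ ∃ K : ℝ,
        ∀ᵐ z ∂(volume.restrict (Ioo (-δ) 0 ×ˢ (univ : Set (EuclideanSpace ℝ (Fin 3))))),
          ‖U z.1 z.2‖ ≤ K) →
      ∀ a : ℝ, 0 < a →
        ∀ᵐ z ∂(volume.restrict (parabolicCylinder a (0 : ℝ × EuclideanSpace ℝ (Fin 3)))), U z.1 z.2 = 0 := by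
  intro U P G M D₀ C hsw hG hI hD hrate htop hlate a ha
  obtain ⟨δ, hδ, K, hK⟩ := hlate
  -- ### `C ≥ 0` (otherwise the rate at `s = -1` is absurd)
  have hC : 0 ≤ C := by
    by_contra hC
    simp only [not_le] at hC
    have h := hrate (-1) (by norm_num)
    rw [neg_neg, Real.sqrt_one, div_one] at h
    have hfalse : ∀ᵐ y : EuclideanSpace ℝ (Fin 3), False := by
      filter_upwards [h] with y hy
      linarith [norm_nonneg (U (-1) y)]
    rw [ae_iff] at hfalse
    simp only [not_false_eq_true, setOf_true] at hfalse
    exact NeZero.ne (volume : Measure (EuclideanSpace ℝ (Fin 3))) (Measure.measure_univ_eq_zero.mp hfalse)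
  -- ### one bound `L` on the window `]−(T+3), 0[ × ℝ³`, `T = a²`
  set T : ℝ := a ^ 2 with hTdef
  have hT0 : 0 < T := by positivity
  set b : ℝ := min (δ / 2) 1 with hbdef
  have hbpos : 0 < b := lt_min (by positivity) one_pos
  have hbδ : b ≤ δ / 2 := min_le_left _ _
  have hb1 : b ≤ 1 := min_le_right _ _
  set L : ℝ := max (max K (C / Real.sqrt b)) 1 with hLdef
  have hL1 : 1 ≤ L := le_max_right _ _
  have hLpos : 0 < L := one_pos.trans_le hL1
  have hKL : K ≤ L := (le_max_left _ _).trans (le_max_left _ _)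
  have hCL : C / Real.sqrt b ≤ L := (le_max_right _ _).trans (le_max_left _ _)
  have hbdW : ∀ᵐ z ∂(volume.restrict (Ioo (-(T + 3)) 0 ×ˢ (univ : Set (EuclideanSpace ℝ (Fin 3))))),
      ‖U z.1 z.2‖ ≤ L := by
    have hcov : Ioo (-(T + 3)) (0 : ℝ) ×ˢ (univ : Set (EuclideanSpace ℝ (Fin 3))) ⊆
        (Ioo (-(T + 3)) (-b) ×ˢ (univ : Set (EuclideanSpace ℝ (Fin 3)))) ∪
          (Ioo (-δ) 0 ×ˢ (univ : Set (EuclideanSpace ℝ (Fin 3)))) := by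
      rintro ⟨s, y⟩ ⟨hs, -⟩
      by_cases hsd : s < -b
      · exact Or.inl ⟨⟨hs.1, hsd⟩, mem_univ _⟩
      · exact Or.inr ⟨⟨by linarith, hs.2⟩, mem_univ _⟩
    refine ae_restrict_of_ae_restrict_of_subset hcov ?_
    rw [ae_restrict_union_iff]
    refine ⟨?_, ?_⟩
    · have h := ae_prod_norm_le_of_rate hsw hrate hC (b := b) (T := T + 3) hbpos (by linarith)
      filter_upwards [h] with z hz using hz.trans hCL
    · filter_upwards [hK] with z hz using hz.trans hKL
  -- ### the sweep depth
  set h : ℝ := (min 1 L⁻¹ / 2) ^ 2 with hhdef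
  have hhpos : 0 < h := by rw [hhdef]; exact pow_pos (div_pos (lt_min one_pos (inv_pos.2 hLpos)) two_pos) 2
  have hh1 : h ≤ 1 := by
    rw [hhdef]
    have h1 : min 1 L⁻¹ / 2 ≤ 1 / 2 := by linarith [min_le_left (1 : ℝ) L⁻¹]
    have h2 : 0 ≤ min 1 L⁻¹ / 2 := (div_pos (lt_min one_pos (inv_pos.2 hLpos)) two_pos).le
    nlinarith
  -- ### the induction: `]−min(h + n h/2, T + 1), 0[ × ℝ³` is cleared
  have step : ∀ D : ℝ, h ≤ D → D ≤ T + 1 →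
      (∀ᵐ z ∂(volume.restrict (Ioo (-D) 0 ×ˢ (univ : Set (EuclideanSpace ℝ (Fin 3))))), U z.1 z.2 = 0) →
      ∀ᵐ z ∂(volume.restrict (Ioo (-(D + h / 2)) 0 ×ˢ (univ : Set (EuclideanSpace ℝ (Fin 3))))),
        U z.1 z.2 = 0 := by
    intro D hhD hDT hclear
    set s₁ : ℝ := -(D - h / 2) with hs₁def
    have hs₁ : s₁ ≤ 0 := by rw [hs₁def]; linarith
    -- the shifted package
    obtain ⟨hsw', hG', hI', hD', hrate'⟩ := apexPackage_timeShift hsw hG hI hD hrate hs₁ hC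
    -- top-vanishing at the new apex: `]s₁ − h/2, s₁[ ⊆ ]−D, 0[` is cleared
    have hclear' : ∀ᵐ z ∂(volume.restrict (Ioo (s₁ - h / 2) s₁ ×ˢ (univ : Set (EuclideanSpace ℝ (Fin 3))))),
        U z.1 z.2 = 0 := by
      refine ae_restrict_of_ae_restrict_of_subset (prod_mono (Ioo_subset_Ioo ?_ ?_) Subset.rfl) hclear
      · rw [hs₁def]; linarith
      · exact hs₁
    have htop' := weakNull_timeShift_of_ae_zero (U := U) (by positivity : 0 < h / 2) hclear'
    -- the far bound of the shifted field on `]−2, 0[ × ℝ³` (inside `]−(T+3), 0[` after the shift)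
    have hbd' : ∀ᵐ z ∂(volume.restrict (Ioo (-(2 : ℝ)) 0 ×ˢ (univ : Set (EuclideanSpace ℝ (Fin 3))))),
        ‖(fun s y => U (s₁ + s) y) z.1 z.2‖ ≤ L := by
      set Tr : ℝ × EuclideanSpace ℝ (Fin 3) → ℝ × EuclideanSpace ℝ (Fin 3) := fun z => (s₁ + z.1, z.2) with hTr
      have hTm : Measurable Tr := (measurable_const.add measurable_fst).prodMk measurable_snd
      have hmp : MeasurePreserving Tr (volume : Measure (ℝ × EuclideanSpace ℝ (Fin 3)))
          (volume : Measure (ℝ × EuclideanSpace ℝ (Fin 3))) :=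
        (measurePreserving_add_left (volume : Measure ℝ) s₁).prod
          (MeasurePreserving.id (volume : Measure (EuclideanSpace ℝ (Fin 3))))
      have hA : MeasurableSet (Ioo (-(T + 3)) (0 : ℝ) ×ˢ (univ : Set (EuclideanSpace ℝ (Fin 3)))) :=
        measurableSet_Ioo.prod MeasurableSet.univ
      have h' := hmp.quasiMeasurePreserving.ae ((ae_restrict_iff' hA).1 hbdW)
      rw [ae_restrict_iff' (measurableSet_Ioo.prod MeasurableSet.univ)]
      filter_upwards [h'] with z hz hzmem
      refine hz ⟨⟨?_, ?_⟩, mem_univ _⟩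
      · show -(T + 3) < s₁ + z.1
        rw [hs₁def]; linarith [hzmem.1.1]
      · show s₁ + z.1 < 0
        linarith [hzmem.1.2]
    -- the sweep for the shifted package
    have hswept := lateSweep_ae_zero hsw' hG' hI' hD' hrate' htop' hLpos (le_refl (2 : ℝ)) hbd'
    -- back to `U`: cleared on `]s₁ − h, s₁[ × ℝ³`
    have hback : ∀ᵐ z ∂(volume.restrict (Ioo (s₁ - h) s₁ ×ˢ (univ : Set (EuclideanSpace ℝ (Fin 3))))),
        U z.1 z.2 = 0 := by
      set Tr : ℝ × EuclideanSpace ℝ (Fin 3) → ℝ × EuclideanSpace ℝ (Fin 3) := fun z => (-s₁ + z.1, z.2) with hTr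
      have hmp : MeasurePreserving Tr (volume : Measure (ℝ × EuclideanSpace ℝ (Fin 3)))
          (volume : Measure (ℝ × EuclideanSpace ℝ (Fin 3))) :=
        (measurePreserving_add_left (volume : Measure ℝ) (-s₁)).prod
          (MeasurePreserving.id (volume : Measure (EuclideanSpace ℝ (Fin 3))))
      have hA : MeasurableSet (Ioo (-h) (0 : ℝ) ×ˢ (univ : Set (EuclideanSpace ℝ (Fin 3)))) :=
        measurableSet_Ioo.prod MeasurableSet.univ
      have hswept' : ∀ᵐ z ∂(volume.restrict (Ioo (-h) (0 : ℝ) ×ˢ (univ : Set (EuclideanSpace ℝ (Fin 3))))),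
          U (s₁ + z.1) z.2 = 0 := by
        have e : -(min 1 L⁻¹ / 2) ^ 2 = -h := by rw [hhdef]
        rw [e] at hswept
        exact hswept
      have h' := hmp.quasiMeasurePreserving.ae ((ae_restrict_iff' hA).1 hswept')
      rw [ae_restrict_iff' (measurableSet_Ioo.prod MeasurableSet.univ)]
      filter_upwards [h'] with z hz hzmem
      have hmem : Tr z ∈ Ioo (-h) (0 : ℝ) ×ˢ (univ : Set (EuclideanSpace ℝ (Fin 3))) := by
        refine ⟨⟨?_, ?_⟩, mem_univ _⟩
        · show -h < -s₁ + z.1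
          linarith [hzmem.1.1]
        · show -s₁ + z.1 < 0
          linarith [hzmem.1.2]
      have := hz hmem
      simpa [hTr] using this
    -- union
    have hcov : Ioo (-(D + h / 2)) (0 : ℝ) ×ˢ (univ : Set (EuclideanSpace ℝ (Fin 3))) ⊆
        (Ioo (s₁ - h) s₁ ×ˢ (univ : Set (EuclideanSpace ℝ (Fin 3)))) ∪
          (Ioo (-D) 0 ×ˢ (univ : Set (EuclideanSpace ℝ (Fin 3)))) := by
      rintro ⟨s, y⟩ ⟨hs, -⟩
      by_cases hsD : -D < s
      · exact Or.inr ⟨⟨hsD, hs.2⟩, mem_univ _⟩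
      · refine Or.inl ⟨⟨?_, ?_⟩, mem_univ _⟩
        · show s₁ - h < s
          rw [hs₁def]; linarith [hs.1]
        · show s < s₁
          rw [hs₁def]; simp only [not_lt] at hsD; linarith
    refine ae_restrict_of_ae_restrict_of_subset hcov ?_
    rw [ae_restrict_union_iff]
    exact ⟨hback, hclear⟩
  -- the base: the sweep for `U` itself
  have hbase : ∀ᵐ z ∂(volume.restrict (Ioo (-h) 0 ×ˢ (univ : Set (EuclideanSpace ℝ (Fin 3))))),
      U z.1 z.2 = 0 := by
    have hbd2 : ∀ᵐ z ∂(volume.restrict (Ioo (-(T + 3)) 0 ×ˢ (univ : Set (EuclideanSpace ℝ (Fin 3))))),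
        ‖U z.1 z.2‖ ≤ L := hbdW
    have := lateSweep_ae_zero hsw hG hI hD hrate htop hLpos (by linarith : (2 : ℝ) ≤ T + 3) hbd2
    have e : -(min 1 L⁻¹ / 2) ^ 2 = -h := by rw [hhdef]
    rw [e] at this
    exact this
  -- ### iterate: depth `D n = min (h + n h/2) (T + 1)`
  have hiter : ∀ n : ℕ, ∀ᵐ z ∂(volume.restrict
      (Ioo (-(min (h + n * (h / 2)) (T + 1))) 0 ×ˢ (univ : Set (EuclideanSpace ℝ (Fin 3))))),
        U z.1 z.2 = 0 := by
    intro n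
    induction n with
    | zero =>
      have e : min (h + ((0 : ℕ) : ℝ) * (h / 2)) (T + 1) = h := by
        rw [Nat.cast_zero, zero_mul, add_zero]
        exact min_eq_left (by linarith)
      rw [e]
      exact hbase
    | succ n ih =>
      by_cases hc : h + n * (h / 2) ≤ T + 1
      · -- the frontier is below `T + 1`: advance by `h/2`
        have hD : min (h + n * (h / 2)) (T + 1) = h + n * (h / 2) := min_eq_left hc
        rw [hD] at ih
        have hhD : h ≤ h + n * (h / 2) := by
          have : (0 : ℝ) ≤ n * (h / 2) := by positivity
          linarith
        have hnext := step (h + n * (h / 2)) hhD hc ih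
        have hle : min (h + ((n + 1 : ℕ) : ℝ) * (h / 2)) (T + 1) ≤ h + n * (h / 2) + h / 2 := by
          rw [Nat.cast_succ]
          refine (min_le_left _ _).trans (le_of_eq ?_)
          ring
        exact ae_restrict_of_ae_restrict_of_subset
          (prod_mono (Ioo_subset_Ioo (by linarith) le_rfl) Subset.rfl) hnext
      · -- saturated: both depths equal `T + 1`
        simp only [not_le] at hc
        have hD : min (h + n * (h / 2)) (T + 1) = T + 1 := min_eq_right hc.le
        have hD' : min (h + ((n + 1 : ℕ) : ℝ) * (h / 2)) (T + 1) = T + 1 := by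
          refine min_eq_right ?_
          rw [Nat.cast_succ]
          nlinarith
        rw [hD'] ; rw [hD] at ih
        exact ih
  -- ### conclusion: choose `n` with `h + n h/2 ≥ T + 1`
  obtain ⟨n, hn⟩ := exists_nat_ge ((T + 1) / (h / 2))
  have hdepth : min (h + n * (h / 2)) (T + 1) = T + 1 := by
    refine min_eq_right ?_
    have h1 : (T + 1) / (h / 2) * (h / 2) = T + 1 := by field_simp
    have h2 : (T + 1) / (h / 2) * (h / 2) ≤ n * (h / 2) :=
      mul_le_mul_of_nonneg_right hn (by positivity)
    linarith
  have hsub : parabolicCylinder a (0 : ℝ × EuclideanSpace ℝ (Fin 3)) ⊆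
      Ioo (-(min (h + n * (h / 2)) (T + 1))) 0 ×ˢ (univ : Set (EuclideanSpace ℝ (Fin 3))) := by
    rw [hdepth]
    rintro ⟨s, y⟩ hz
    rw [mem_parabolicCylinder] at hz
    refine ⟨⟨?_, by simpa using hz.1.2⟩, mem_univ _⟩
    have : (0 : ℝ × EuclideanSpace ℝ (Fin 3)).1 - a ^ 2 < s := hz.1.1
    simp only [Prod.fst_zero, zero_sub] at this
    show -(T + 1) < s
    linarith
  exact ae_restrict_of_ae_restrict_of_subset hsub (hiter n)

end Summit.NavierStokesRegularity.NavierStokesRegularity.Theorems.TypeITraceScarL3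

end
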